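import Literature.NumberTheory.LFunctions.Zhang2022.Section18AllIota
import Literature.Analysis.ValidatedNumerics.BoxCover

/-!
# Zhang (2022) §18-margin repair rung: the cover frame for a barrier over a parameter class

Trunk T-ANT (NumberTheory/LFunctions). Infrastructure for the REPAIR-or-BARRIER study of the
failing inequality of record `Skeleton.Margin232` of Y. Zhang, arXiv:2211.02515v1, §18
[Zhang2022LandauSiegel] (refuted at the printed parameters: `Skeleton.not_margin232`; for
every `ι ∈ ℂ³` at the printed exponents: `Section18AllIota.C232G_ge`). A BARRIER over a
parameter class `R` is the statement `∀ θ ∈ R, m₀ ≤ 𝔠₁(θ) + 𝔠₂(θ) + 2 Re 𝔠₃(θ)`; since the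
margin is a Hermitian form `x* Q(θ) x`, `x = (1, ι₂, ι₃, ι₄)` (`Section18AllIota.form_QM`), the
`ι`-directions are eliminated EXACTLY by positive semidefiniteness of `Q(θ) − m₀e₀e₀ᵀ`, and what
remains is a claim over the REAL coordinates of `θ` (exponents, shifts, …), to be certified box
by box. This file is the generic frame for that (nothing here is specific to the entries of `Q`):

* `coverCheck`, `CoverMem`, `coverCheck_sound`: a cover is a list of root boxes, each with a
  kd-tree certificate (`Literature.Analysis.ValidatedNumerics.KdCert`, `BoxCover.lean`); a claim
  relative to a region predicate `R` (`kdCheck_sound_on`: leaves outside `R` may be discharged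
  by an EXCLUDER instead of a certificate);
* `PsdLeaf` (literal box table + integer approximate eigenbasis) and the leaf check `psdLeafOK`
  = validity flag ∧ `cmatEncl lit (QB B)` ∧ `hermPsdCheck lit basis` — the per-leaf form of the
  certificate `Section18AllIota.cert18all_p` — with `psdLeafOK_sound`,
  `posSemidef_of_coverCheck`: an accepted cover proves `∀ x ∈ cover, R x → (Q x).PosSemidef`
  for any matrix family `Q` enclosed on boxes by `QB`;
* `re_form_nonneg_of_posSemidef`, `le_of_posSemidef_form`: from `Q ⪰ 0` and a form identity
  `Re(v* Q v) = F − m` to `m ≤ F` (the step `Section18AllIota.C232X_ge_of_posSemidef`);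
* linear excluders: `linEval`, `linMin`, `LinCon` (`Σ aᵢxᵢ ≤ d`), `linExcl cs B` = some
  constraint of `cs` is violated on all of `B`, `linExcl_sound`;
* `forall_class_of_cover`: the assembly pattern `(∀ θ, Adm θ → coords θ ∈ cover ∧ R (coords θ))
  → (∀ x ∈ cover, R x → P x) → ∀ θ, Adm θ → P (coords θ)`.

No statement about the manuscript is made here; no facts, no axioms beyond the standard three.

## References
* R. E. Moore, *Interval Analysis*, Prentice-Hall (1966), Theorem 3.1 and §4.4 (inclusion
  property; refinement by subdivision). [Moore1966]
* S. M. Rump, *Verification of positive definiteness*, BIT 46 (2006) 433–452. [Rump2006]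
-/

noncomputable section

open Matrix
open scoped ComplexOrder
open Literature.Analysis.ValidatedNumerics (Box KdCert)
open Literature.Analysis.ValidatedNumerics.Numerics
open Literature.Analysis.ValidatedNumerics.IntervalGershgorin

namespace Literature.NumberTheory.LFunctions.Zhang2022

/-! ### Covers: lists of root boxes with kd-tree certificates, claims relative to a region -/

/-- **Restricted soundness of kd-tree certificates**: if every accepted leaf proves `P` at the
points of its box that lie in the region `R`, an accepted tree proves `P` on `root ∩ R`.
[cite: Moore1966, §4.4] -/
theorem kdCheck_sound_on {α : Type} {P R : (ℕ → ℝ) → Prop} {leafOK : Box → α → Bool}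
    (hleaf : ∀ B a, leafOK B a = true → ∀ x, B.mem x → R x → P x) (t : KdCert α) (root : Box)
    (h : t.check leafOK root = true) : ∀ x, root.mem x → R x → P x :=
  KdCert.sound (P := fun x => R x → P x) hleaf t root h

/-- A cover: root boxes, each with its kd-tree certificate; `coverCheck` runs every tree.
[folklore] -/
def coverCheck {α : Type} (leafOK : Box → α → Bool) : List (Box × KdCert α) → Bool
  | [] => true
  | (B, t) :: rest => t.check leafOK B && coverCheck leafOK rest

/-- A point is covered: it lies in one of the root boxes. [cite: Moore1966, §4.4] -/
def CoverMem {α : Type} (roots : List (Box × KdCert α)) (x : ℕ → ℝ) : Prop :=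
  ∃ Bt ∈ roots, Bt.1.mem x

/-- **Soundness of a cover.** [cite: Moore1966, §4.4] -/
theorem coverCheck_sound {α : Type} {P R : (ℕ → ℝ) → Prop} {leafOK : Box → α → Bool}
    (hleaf : ∀ B a, leafOK B a = true → ∀ x, B.mem x → R x → P x) :
    ∀ roots : List (Box × KdCert α), coverCheck leafOK roots = true →
      ∀ x, CoverMem roots x → R x → P x
  | [], _, x, hx, _ => by obtain ⟨Bt, hBt, _⟩ := hx; simp at hBt
  | (B, t) :: rest, h, x, hx, hR => by
    rw [coverCheck, Bool.and_eq_true] at h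
    obtain ⟨Bt, hBt, hmem⟩ := hx
    rcases List.mem_cons.1 hBt with rfl | hrest
    · exact kdCheck_sound_on hleaf t B h.1 x hmem hR
    · exact coverCheck_sound hleaf rest h.2 x ⟨Bt, hrest, hmem⟩ hR

/-- A point lies in a box as soon as its stored coordinates lie in the stored intervals and all
further coordinates vanish (the `[0, 0]` convention of `Box.mem`). [cite: Moore1966, §4.4] -/
theorem Box_mem_of_forall {B : Box} {x : ℕ → ℝ}
    (h : ∀ i, i < B.length → ((B.ivl i).1 : ℝ) ≤ x i ∧ x i ≤ ((B.ivl i).2 : ℝ))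
    (h0 : ∀ i, B.length ≤ i → x i = 0) : B.mem x := by
  intro i
  by_cases hi : i < B.length
  · exact h i hi
  · have hz := h0 i (not_lt.1 hi)
    have hivl : B.ivl i = (0, 0) := by
      unfold Box.ivl
      rw [List.getD_eq_getElem?_getD, List.getElem?_eq_none (not_lt.1 hi)]
      rfl
    rw [hivl, hz]
    simp

/-! ### PSD leaves: literal box table + integer eigenbasis, checked by `cmatEncl` + `hermPsdCheck` -/

/-- Datum of a PSD leaf: a LITERAL box table `lit` claimed to enclose the box evaluation of the
matrix family on the leaf box, and an integer approximate eigenbasis for the realified interval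
test (`hermPsdCheck`). The literal table keeps the kernel from re-evaluating the entry enclosures
inside the congruence (the design of `Section18AllIota.cert18all_p`). [cite: Rump2006, §1] -/
structure PsdLeaf (n : ℕ) where
  /-- literal box table (entrywise ⊇ the computed boxes on the leaf) -/
  lit : CMat n
  /-- integer approximate eigenbasis of the realification, columns, any scale -/
  basis : Fin (n + n) → Fin (n + n) → ℤ

/-- **The PSD leaf check.** `none`: the excluder `excl` certifies that the box misses the region;
`some leaf`: the box evaluation is valid (`ok B`), lies in the literal table, and the literal table
passes the interval PSD test. [cite: Rump2006, §1] -/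
def psdLeafOK {n : ℕ} (excl ok : Box → Bool) (QB : Box → CMat n) (B : Box) :
    Option (PsdLeaf n) → Bool
  | none => excl B
  | some leaf => ok B && (cmatEncl leaf.lit (QB B) && hermPsdCheck leaf.lit leaf.basis)

/-- **Soundness of the PSD leaf check** for a matrix family `Q` (Hermitian on the region `R`)
enclosed on every valid box by `QB`. [cite: Rump2006, §1] -/
theorem psdLeafOK_sound {n : ℕ} {R : (ℕ → ℝ) → Prop} {Q : (ℕ → ℝ) → Matrix (Fin n) (Fin n) ℂ}
    {excl ok : Box → Bool} {QB : Box → CMat n}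
    (hexcl : ∀ B, excl B = true → ∀ x, B.mem x → ¬ R x)
    (hQB : ∀ B, ok B = true → ∀ x, B.mem x → R x → CMMem (Q x) (QB B))
    (hH : ∀ x, R x → (Q x)ᴴ = Q x) :
    ∀ B (a : Option (PsdLeaf n)), psdLeafOK excl ok QB B a = true →
      ∀ x, B.mem x → R x → (Q x).PosSemidef := by
  intro B a h x hx hR
  cases a with
  | none => exact absurd hR (hexcl B h x hx)
  | some leaf =>
    simp only [psdLeafOK, Bool.and_eq_true] at h
    obtain ⟨hok, hencl, hpsd⟩ := h
    exact posSemidef_of_hermPsdCheck hpsd (cmmem_of_cmatEncl hencl (hQB B hok x hx hR)) (hH x hR)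

/-- **PSD on a certified cover**: `∀ x ∈ cover ∩ R, Q x ⪰ 0`. [cite: Rump2006, §1] -/
theorem posSemidef_of_coverCheck {n : ℕ} {R : (ℕ → ℝ) → Prop}
    {Q : (ℕ → ℝ) → Matrix (Fin n) (Fin n) ℂ} {excl ok : Box → Bool} {QB : Box → CMat n}
    (hexcl : ∀ B, excl B = true → ∀ x, B.mem x → ¬ R x)
    (hQB : ∀ B, ok B = true → ∀ x, B.mem x → R x → CMMem (Q x) (QB B))
    (hH : ∀ x, R x → (Q x)ᴴ = Q x) {roots : List (Box × KdCert (Option (PsdLeaf n)))}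
    (h : coverCheck (psdLeafOK excl ok QB) roots = true) :
    ∀ x, CoverMem roots x → R x → (Q x).PosSemidef :=
  coverCheck_sound (psdLeafOK_sound hexcl hQB hH) roots h

/-! ### From positive semidefiniteness to a lower bound of a Hermitian form -/

/-- `Re(v* Q v) ≥ 0` for `Q ⪰ 0`. [cite: Rump2006, §1] -/
theorem re_form_nonneg_of_posSemidef {n : ℕ} {Q : Matrix (Fin n) (Fin n) ℂ} (hQ : Q.PosSemidef)
    (v : Fin n → ℂ) : 0 ≤ (star v ⬝ᵥ (Q *ᵥ v)).re := by
  have h0 := hQ.dotProduct_mulVec_nonneg v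
  rw [Complex.nonneg_iff] at h0
  exact h0.1

/-- **The barrier step**: if `Re(v* Q v) = F − m` and `Q ⪰ 0` then `m ≤ F` (for the margin:
`v = (1, ι₂, ι₃, ι₄)`, `F = 𝔠₁ + 𝔠₂ + 2 Re 𝔠₃`, cf. `Section18AllIota.C232X_ge_of_posSemidef`).
[cite: Zhang2022LandauSiegel, (2.32)] -/
theorem le_of_posSemidef_form {n : ℕ} {Q : Matrix (Fin n) (Fin n) ℂ} (hQ : Q.PosSemidef)
    {v : Fin n → ℂ} {F m : ℝ} (hform : (star v ⬝ᵥ (Q *ᵥ v)).re = F - m) : m ≤ F := by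
  have h := re_form_nonneg_of_posSemidef hQ v
  rw [hform] at h
  linarith

/-! ### Linear excluders: boxes on which an affine constraint of the class fails -/

/-- `Σ_{j} a_j x_{i+j}` for a coefficient list `a` starting at coordinate `i`. [folklore] -/
def linEval : List ℚ → ℕ → (ℕ → ℝ) → ℝ
  | [], _, _ => 0
  | a :: as, i, x => (a : ℝ) * x i + linEval as (i + 1) x

/-- The minimum of `linEval a i` over a box, computed endpointwise. [folklore] -/
def linMin : List ℚ → ℕ → Box → ℚ
  | [], _, _ => 0
  | a :: as, i, B => (if 0 ≤ a then a * (B.ivl i).1 else a * (B.ivl i).2) + linMin as (i + 1) B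

/-- `linMin` is a lower bound for `linEval` on the box. [cite: Moore1966, Theorem 3.1] -/
theorem linMin_le_linEval {B : Box} {x : ℕ → ℝ} (hx : B.mem x) :
    ∀ (as : List ℚ) (i : ℕ), (linMin as i B : ℝ) ≤ linEval as i x
  | [], i => by simp [linMin, linEval]
  | a :: as, i => by
    have ih := linMin_le_linEval hx as (i + 1)
    have hi := hx i
    simp only [linMin, linEval, Rat.cast_add]
    refine add_le_add ?_ ih
    by_cases ha : 0 ≤ a
    · rw [if_pos ha, Rat.cast_mul]
      exact mul_le_mul_of_nonneg_left hi.1 (by exact_mod_cast ha)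
    · rw [if_neg ha, Rat.cast_mul]
      exact mul_le_mul_of_nonpos_left hi.2 (by exact_mod_cast (not_le.1 ha).le)

/-- An affine constraint `Σ aᵢxᵢ ≤ d` with rational data (coefficients from coordinate `0`).
[cite: Moore1966, Theorem 3.1] -/
structure LinCon where
  /-- coefficients `a₀, a₁, …` -/
  coef : List ℚ
  /-- right-hand side `d` -/
  rhs : ℚ

/-- The constraint holds at a real point. [cite: Moore1966, Theorem 3.1] -/
def LinCon.Holds (c : LinCon) (x : ℕ → ℝ) : Prop := linEval c.coef 0 x ≤ c.rhs

/-- The constraint fails at every point of the box (its minimum over the box exceeds `d`).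
[folklore] -/
def LinCon.violatedOn (c : LinCon) (B : Box) : Bool := decide (c.rhs < linMin c.coef 0 B)

/-- Soundness of `violatedOn`. [cite: Moore1966, Theorem 3.1] -/
theorem LinCon.not_holds_of_violatedOn {c : LinCon} {B : Box} (h : c.violatedOn B = true)
    {x : ℕ → ℝ} (hx : B.mem x) : ¬ c.Holds x := by
  unfold LinCon.violatedOn at h
  have h' : (c.rhs : ℝ) < linMin c.coef 0 B := by exact_mod_cast of_decide_eq_true h
  unfold LinCon.Holds
  intro hle
  linarith [linMin_le_linEval hx c.coef 0]

/-- A polytope class in coordinates: all constraints hold. [cite: Moore1966, Theorem 3.1] -/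
def LinHolds (cs : List LinCon) (x : ℕ → ℝ) : Prop := ∀ c ∈ cs, c.Holds x

/-- **Linear excluder**: some constraint of the class is violated on the whole box. [folklore] -/
def linExcl (cs : List LinCon) (B : Box) : Bool := cs.any fun c => c.violatedOn B

/-- Soundness of the linear excluder: an excluded box misses the polytope. [cite: Moore1966, Theorem 3.1] -/
theorem linExcl_sound {cs : List LinCon} {B : Box} (h : linExcl cs B = true) {x : ℕ → ℝ}
    (hx : B.mem x) : ¬ LinHolds cs x := by
  unfold linExcl at h
  rw [List.any_eq_true] at h
  obtain ⟨c, hc, hv⟩ := h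
  exact fun hall => LinCon.not_holds_of_violatedOn hv hx (hall c hc)

/-! ### Assembly pattern -/

/-- **From a certified cover to a statement over a parameter class.** `Adm` is the class
predicate on the parameter type, `coords` its real coordinates, `R` the coordinate-level region
used by the leaves (e.g. `LinHolds cs`), `P` the certified property. [cite: Moore1966, §4.4] -/
theorem forall_class_of_cover {Θ : Type*} {α : Type} {Adm : Θ → Prop} {coords : Θ → ℕ → ℝ}
    {R P : (ℕ → ℝ) → Prop} (roots : List (Box × KdCert α))
    (hcov : ∀ θ, Adm θ → CoverMem roots (coords θ) ∧ R (coords θ))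
    (hP : ∀ x, CoverMem roots x → R x → P x) : ∀ θ, Adm θ → P (coords θ) :=
  fun θ hθ => hP (coords θ) (hcov θ hθ).1 (hcov θ hθ).2

end Literature.NumberTheory.LFunctions.Zhang2022
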